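import Summits.NavierStokesRegularity.NavierStokesRegularity.Theorems.ScenarioCensusPressureMeterHead
import HarnessLib

/-!
# LINE «pressure-meter» REV 4 port, part 5/6: §D (first part) the rows `Row_A1pe` / `Row_A1p0` / `Row_A1pd` (OPEN) / `Row_A7s` (OPEN) / `Row_A1pw` / `Row_A1hw` / `Row_A1bw` /
# `Row_A1gw` / `Row_A1ma` / `Row_A1ac`, nestings, `row_A1pw_holds`, `row_A1pe_holds'`

Re-homed for the scenario census (typer seat ns-census-typer-1 g8; the cells A1pe / A1p0 / A1pw / A1hw / A1bw / A1gw / A1ma / A1ac are MEMBERS OF RECORD «DECIDED IN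
KERNEL IN FILES» of block A2 since census v1.73 (critic idea-crit-3 g7 PASS — no price 00:07:29Z on REV 3, RE-STAMP 00:39:59Z on REV 4; ref ns-census-ref g9
PRE-CHECK ✓ §14.22 item 33 / §14.24 item 33′; lead-presearch label); this port makes them TREE-decided): VERBATIM PORT of ns-idea-2 LINE g13-3 «pressure-meter»
REV 4, `pub/ideators/ns-idea-2/lines/pressure-meter/line-pressure-meter.rev4.lean` sha16 7fb3f23e01caeb0c (1616 l., lean check rc 0, 0 sorry), split for the
400-line rule into `ScenarioCensusPressureMeter` (§A–§C engine) → `…PressureMeterForce` (§C end, §C′ start) → `…PressureMeterWork` (§C′ maximum principle) →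
`…PressureMeterHead` (§C″) → `…PressureMeterRows` (§D rows, nestings) → `…PressureMeterCells` (§D holds + census KEYS).  Lean text VERBATIM in namespace
`…Theorems.ScenarioCensus.PressureMeter` (the line's `…Lines.PressureMeter` re-homed); port edits: `local notation "E3"` → `abbrev E3` (typer lint: no notation in
port files), `@[conjecture]` on the OPEN rows `Row_A1pd` / `Row_A7s` (typed only, ∃-cells), seven one-line docstrings added (gate lint); `tendsto_typeI_bound`
(`C/√(-s) → 0`, twin of a landed tree lemma in a module the farm does not build — gate lint dedup.landed) is not re-declared and its three uses carry the
one-line Mathlib proof inline (proof text only); the line's `set_option maxHeartbeats 400000 in` on the (θ, σ)-engine is kept as filed.  Statements untouched.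

No census VALUE is moved here (the members become TREE-decided by name); NS regularity is NOT proved; (L′) ⟨10661⟩ is untouched; no summit statement is
proved by this file.
-/

-- the summit and its single problem share the name `NavierStokesRegularity` (D-0017 nested layout)
set_option linter.dupNamespace false

noncomputable section

open Set Function Filter Topology Metric

namespace Summit.NavierStokesRegularity.NavierStokesRegularity.Theorems.ScenarioCensus.PressureMeter

open Literature.Analysis Literature.Analysis.FluidPDE InnerProductSpace
open Summit.NavierStokesRegularity.NavierStokesRegularity.Theorems.SimilarityEnstrophy
  (typeI_ancient_eq_zero_of_rate_lt_one)
open scoped Laplacian InnerProductSpace RealInnerProductSpace ContDiff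

/-! ## D. The rows (census A-block cells, (L′)-shape over `IsTypeIAncientMild C u` BY NAME) -/

/-- **Row A1pe (pressure-force window; HEAD, PROVED).**  A Type-I ancient mild field (KNSS gauge,
`ν = 1`) whose pressure force is scale-invariantly small,
`(-t)^{3/2} ‖∂ₜu + (u·∇)u − Δu‖ = (-t)^{3/2} ‖∇p‖ ≤ η` with `2η < 1`, vanishes identically. -/
def Row_A1pe : Prop :=
  ∀ (C : ℝ) (u : ℝ → E3 → E3), IsTypeIAncientMild C u →
    ∀ η : ℝ, 2 * η < 1 →
      (∀ t < 0, ∀ x, ‖deriv (fun τ => u τ x) t + convect (u t) (u t) x - (Δ (u t)) x‖ ≤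
        η / ((-t) * Real.sqrt (-t))) →
      ∀ t < 0, ∀ x, u t x = 0

/-- **Row A1p0 (pressureless cell, PROVED).**  A Type-I ancient mild field with spatially constant
pressure — equivalently, solving the viscous vector BURGERS system `∂ₜu + (u·∇)u = Δu` classically on
`(-∞, 0) × ℝ³` — vanishes identically. -/
def Row_A1p0 : Prop :=
  ∀ (C : ℝ) (u : ℝ → E3 → E3), IsTypeIAncientMild C u →
    (∀ t < 0, ∀ x, deriv (fun τ => u τ x) t + convect (u t) (u t) x = (Δ (u t)) x) →
      ∀ t < 0, ∀ x, u t x = 0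

/-- **Row A1pd (ONE-DIRECTIONAL pressure-force window; OPEN, typed).**  For some universal `η₀ > 0`:
a Type-I ancient mild field whose pressure force has scale-invariantly small component along ONE fixed
unit direction `e`, `(-t)^{3/2} |⟪e, ∇p⟫| ≤ η₀`, vanishes identically.  Reduces (PROVED,
`row_A1pd_of_row_A7s`) to the one-small-component cell `Row_A7s`. -/
@[conjecture] def Row_A1pd : Prop :=
  ∃ η₀ : ℝ, 0 < η₀ ∧
    ∀ (C : ℝ) (u : ℝ → E3 → E3), IsTypeIAncientMild C u →
      ∀ e : E3, ‖e‖ = 1 →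
        (∀ t < 0, ∀ x, |⟪e, deriv (fun τ => u τ x) t + convect (u t) (u t) x - (Δ (u t)) x⟫| ≤
          η₀ / ((-t) * Real.sqrt (-t))) →
        ∀ t < 0, ∀ x, u t x = 0

/-- **Row A7s (one scale-invariantly SMALL velocity component; OPEN, typed — the quantitative neighbour
of census A7h `u₃ ≡ 0`, the ancient twin of the forward rows F1nv/F1flat).**  For some universal `δ₀ > 0`:
a Type-I ancient mild field with `√(-t) |⟪e, u(t, x)⟫| ≤ δ₀` for ONE fixed unit direction `e`
vanishes identically. -/
@[conjecture] def Row_A7s : Prop :=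
  ∃ δ₀ : ℝ, 0 < δ₀ ∧
    ∀ (C : ℝ) (u : ℝ → E3 → E3), IsTypeIAncientMild C u →
      ∀ e : E3, ‖e‖ = 1 → (∀ t < 0, ∀ x, |⟪e, u t x⟫| ≤ δ₀ / Real.sqrt (-t)) →
        ∀ t < 0, ∀ x, u t x = 0

/-- **Row A1pw (one-sided STREAMLINE pressure-work window; HEAD, PROVED `row_A1pw_holds`).**  A Type-I ancient mild field along which the pressure force does scale-invariantly little
work per unit speed, `⟪u, -∇p⟫ ≤ η (-t)^{-3/2} ‖u‖` (equivalently: the pressure DROP rate along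
streamlines, `-∂ₛp`, never exceeds `η (-t)^{-3/2}`; no lower bound is asked), with `2η < 1`, vanishes
identically.  One-sided and scalar; it contains `Row_A1pe` (PROVED nesting `row_A1pe_of_row_A1pw`,
Cauchy–Schwarz).  Proof (Part C′): the regularised modulus `ρ_κ = √(κ² + |u|²)` is a classical
sub-solution of `∂ₜρ + u·∇ρ − Δρ ≤ η (-t)^{-3/2}` by Kato's inequality `ρ_κ Δρ_κ ≥ ⟪u, Δu⟫`
(`inner_laplacian_le_rmod_mul_laplacian`, from tree `laplacian_inner_self_eq` and
`LoewnerNirenberg.laplacian_smul_apply`), the barrier argument of Part C applies verbatim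
(`rmod_le_window`), then `κ → 0`, `s → -∞` (`norm_le_of_pressureWork`): Type-I constant `2η < 1`, and
the tree's rate theorem concludes. -/
def Row_A1pw : Prop :=
  ∀ (C : ℝ) (u : ℝ → E3 → E3), IsTypeIAncientMild C u →
    ∀ η : ℝ, 2 * η < 1 →
      (∀ t < 0, ∀ x, ⟪u t x, deriv (fun τ => u τ x) t + convect (u t) (u t) x - (Δ (u t)) x⟫ ≤
        η * ‖u t x‖ / ((-t) * Real.sqrt (-t))) →
      ∀ t < 0, ∀ x, u t x = 0

/-- Nesting (PROVED): the streamline-work window contains the pressure-force window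
(`⟪u, F⟫ ≤ ‖u‖ ‖F‖`). -/
theorem row_A1pe_of_row_A1pw : Row_A1pw → Row_A1pe := by
  intro h C u hu η hη hres
  refine h C u hu η hη fun t ht x => ?_
  rw [← pressureForce_apply]
  have h1 : ⟪u t x, pressureForce u t x⟫ ≤ ‖u t x‖ * ‖pressureForce u t x‖ :=
    real_inner_le_norm _ _
  have h2 : ‖pressureForce u t x‖ ≤ η / ((-t) * Real.sqrt (-t)) := by
    rw [pressureForce_apply]; exact hres t ht x
  have h3 : ‖u t x‖ * ‖pressureForce u t x‖ ≤ ‖u t x‖ * (η / ((-t) * Real.sqrt (-t))) :=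
    mul_le_mul_of_nonneg_left h2 (norm_nonneg _)
  have h4 : ‖u t x‖ * (η / ((-t) * Real.sqrt (-t))) = η * ‖u t x‖ / ((-t) * Real.sqrt (-t)) := by
    ring
  linarith

/-- **Row A1pw holds** (streamline-work maximum principle for the regularised modulus ⇒ Type-I
constant `2η < 1` ⇒ the tree's time-only small-rate Liouville theorem
`SimilarityEnstrophy.typeI_ancient_eq_zero_of_rate_lt_one`).  A negative level `η < 0` is an instance of
the level-`0` hypothesis. -/
theorem row_A1pw_holds : Row_A1pw := by
  intro C u hu η hη hres
  have key : ∀ η' : ℝ, 0 ≤ η' → 2 * η' < 1 →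
      (∀ t < 0, ∀ x, ⟪u t x, pressureForce u t x⟫ ≤ η' * ‖u t x‖ / ((-t) * Real.sqrt (-t))) →
      ∀ t < 0, ∀ x, u t x = 0 := fun η' h0 h1 h =>
    typeI_ancient_eq_zero_of_rate_lt_one (isTypeIAncientMild_two_mul_of_pressureWork hu h0 h) h1
  by_cases hη0 : 0 ≤ η
  · exact key η hη0 hη fun t ht x => by rw [pressureForce_apply]; exact hres t ht x
  · push Not at hη0
    refine key 0 le_rfl (by norm_num) fun t ht x => ?_
    rw [pressureForce_apply]
    refine (hres t ht x).trans ?_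
    have hden : 0 < (-t) * Real.sqrt (-t) := by
      have : 0 < -t := neg_pos.2 ht
      positivity
    have h1 : η * ‖u t x‖ / ((-t) * Real.sqrt (-t)) ≤ 0 :=
      div_nonpos_of_nonpos_of_nonneg (mul_nonpos_of_nonpos_of_nonneg hη0.le (norm_nonneg _)) hden.le
    have h2 : (0 : ℝ) * ‖u t x‖ / ((-t) * Real.sqrt (-t)) = 0 := by ring
    linarith

/-- Second proof of `Row_A1pe`, through the streamline-work head. -/
theorem row_A1pe_holds' : Row_A1pe := row_A1pe_of_row_A1pw row_A1pw_holds

/-- **Row A1hw — the GENERALISED-HEAD WORK DIAL (PROVED `row_A1hw_holds`, REV 3; one cell for every real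
weight `θ`).**  For a Type-I ancient mild field and ANY `θ : ℝ`: if the residual work
`⟪u, ∂ₜu⟫ + θ ⟪u, (u·∇)u⟫ - ⟪u, Δu⟫ ≤ η ‖u‖ (-t)^{-3/2}` everywhere with `2η < 1`, then `u ≡ 0`.  Along the
classical solution (`∂ₜu + (u·∇)u - Δu = -∇p`) the left side is `-u·∇p - (1-θ) u·∇(|u|²/2)
= -u·∇H_θ` with the generalised head `H_θ := p + (1-θ)|u|²/2` (`inner_convect_self_eq`): `θ = 1` is the
pressure-work cell `Row_A1pw`, `θ = 0` the BERNOULLI-HEAD cell `Row_A1bw` (`H₀ = p + |u|²/2`, the total head;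
Lamb form `∂ₜu + ω × u + ∇H₀ = Δu`, `⟪u, ω × u⟫ = 0`), `θ = 2` the cell of `p - |u|²/2`.  READING: for every
`θ`, a non-zero Type-I singularity model has points where `H_θ` DROPS along streamlines at scale-invariant rate
`-u·∇H_θ / |u| ≥ ½ (-t)^{-3/2}`.  Proof: `rmod_le_window_head` (barrier exponent `|θ|V + 7`) ⇒
`norm_le_of_headWork` ⇒ Type-I constant `2η` ⇒ A2a BY NAME. -/
def Row_A1hw : Prop :=
  ∀ (C : ℝ) (u : ℝ → E3 → E3), IsTypeIAncientMild C u →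
    ∀ θ η : ℝ, 2 * η < 1 →
      (∀ t < 0, ∀ x, ⟪u t x, deriv (fun τ => u τ x) t⟫ + θ * ⟪u t x, convect (u t) (u t) x⟫ -
          ⟪u t x, (Δ (u t)) x⟫ ≤ η * ‖u t x‖ / ((-t) * Real.sqrt (-t))) →
      ∀ t < 0, ∀ x, u t x = 0

/-- **Row A1bw — the BERNOULLI-HEAD WORK CELL (PROVED by nesting, `θ = 0`).**  If the caloric residual work
`⟪u, ∂ₜu - Δu⟫ = -u·∇(p + |u|²/2)` satisfies `⟪u, ∂ₜu - Δu⟫ ≤ η ‖u‖ (-t)^{-3/2}` everywhere with `2η < 1`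
(the total head never drops along streamlines faster than `η (-t)^{-3/2}` per unit speed), then `u ≡ 0`.
The ancient-class, streamline-DERIVATIVE counterpart of the one-sided HEAD bounds of the forward routes
(Seregin–Šverák 2002; tree `SereginSverakPressureMonotone`) and of the head maximum principle of the steady
Liouville problem (Gilbarg–Weinberger, Amick, Korobkov–Pileckas–Russo; census S-block). -/
def Row_A1bw : Prop :=
  ∀ (C : ℝ) (u : ℝ → E3 → E3), IsTypeIAncientMild C u →
    ∀ η : ℝ, 2 * η < 1 →
      (∀ t < 0, ∀ x, ⟪u t x, deriv (fun τ => u τ x) t - (Δ (u t)) x⟫ ≤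
        η * ‖u t x‖ / ((-t) * Real.sqrt (-t))) →
      ∀ t < 0, ∀ x, u t x = 0

/-- **Row A1gw — the TWO-PARAMETER RESIDUAL METER (PROVED `row_A1gw_holds`, REV 4; one cell for every
weight `θ : ℝ` on the convective work and every DIFFUSION WEIGHT `σ ≥ 0`).**  If
`⟪u, ∂ₜu⟫ + θ⟪u, (u·∇)u⟫ − σ⟪u, Δu⟫ ≤ η ‖u‖ (-t)^{-3/2}` everywhere with `2η < 1`, then `u ≡ 0`.  `σ = 1` is the
head dial `Row_A1hw`; `σ = 0` removes the viscous term altogether: `(θ, σ) = (1, 0)` is the MATERIAL-ACCELERATION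
cell `Row_A1ma` (`⟪u, Du/Dt⟫ = |u| D|u|/Dt`: Lagrangian speed-up), and the corner `(0, 0)` (`⟪u, ∂ₜu⟫ = |u|∂ₜ|u|`,
Eulerian speed-up) is elementary (monotonicity + the class decay) and not listed as a row.  The regularised
modulus is a sub-solution of the model operator `∂ₜ + θ u·∇ − σΔ` (Kato's inequality enters with the factor
`σ ≥ 0`; `σ < 0` would be backward diffusion and is excluded); barrier exponent `β = |θ|V + 6σ + 1`. -/
def Row_A1gw : Prop :=
  ∀ (C : ℝ) (u : ℝ → E3 → E3), IsTypeIAncientMild C u →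
    ∀ θ σ η : ℝ, 0 ≤ σ → 2 * η < 1 →
      (∀ t < 0, ∀ x, ⟪u t x, deriv (fun τ => u τ x) t⟫ + θ * ⟪u t x, convect (u t) (u t) x⟫ -
          σ * ⟪u t x, (Δ (u t)) x⟫ ≤ η * ‖u t x‖ / ((-t) * Real.sqrt (-t))) →
      ∀ t < 0, ∀ x, u t x = 0

/-- **Row A1ma — the MATERIAL-ACCELERATION (Lagrangian speed-up) cell (PROVED by nesting, `θ = 1`, `σ = 0`).**
If the work of the material acceleration satisfies `⟪u, ∂ₜu + (u·∇)u⟫ ≤ η ‖u‖ (-t)^{-3/2}` everywhere with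
`2η < 1` — no fluid particle ever gains speed faster than `η (-t)^{-3/2}` (`D|u|/Dt ≤ η(-t)^{-3/2}` where
`u ≠ 0`; `Du/Dt = Δu − ∇p`) — then `u ≡ 0`.  READING: Type-I blow-up needs LAGRANGIAN SPEED-UP of scale-invariant
order `½` somewhere; the classical proof is by characteristics (backward particle paths exist on every window and
the class bound at the far past is the datum), the kernel proof is the barrier comparison with `σ = 0`. -/
def Row_A1ma : Prop :=
  ∀ (C : ℝ) (u : ℝ → E3 → E3), IsTypeIAncientMild C u →
    ∀ η : ℝ, 2 * η < 1 →
      (∀ t < 0, ∀ x, ⟪u t x, deriv (fun τ => u τ x) t + convect (u t) (u t) x⟫ ≤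
        η * ‖u t x‖ / ((-t) * Real.sqrt (-t))) →
      ∀ t < 0, ∀ x, u t x = 0

/-- **Row A1ac — the small MATERIAL-ACCELERATION window (PROVED by nesting from `Row_A1ma`, Cauchy–Schwarz).**
`‖∂ₜu + (u·∇)u‖ = ‖Δu − ∇p‖ ≤ η (-t)^{-3/2}` everywhere with `2η < 1` ⇒ `u ≡ 0`: a Type-I singularity model in
which the viscous force balances the pressure force up to a scale-invariantly small remainder does not exist. -/
def Row_A1ac : Prop :=
  ∀ (C : ℝ) (u : ℝ → E3 → E3), IsTypeIAncientMild C u →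
    ∀ η : ℝ, 2 * η < 1 →
      (∀ t < 0, ∀ x, ‖deriv (fun τ => u τ x) t + convect (u t) (u t) x‖ ≤
        η / ((-t) * Real.sqrt (-t))) →
      ∀ t < 0, ∀ x, u t x = 0

end Summit.NavierStokesRegularity.NavierStokesRegularity.Theorems.ScenarioCensus.PressureMeter

end
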